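import Summits.QuantumFields.BalabanUV.T4Continuum.Support.NE3EnergyWeightedSupShape
import Literature.MathematicalPhysics.QuantumFieldTheory.Balaban1983to89.T4EtaRateMin

/-!
# NE7EtaMinimiserSocket — route #1 of the NE7 crux, stub S2: row NE3's re-typed root T-E_w♯
# (`NE3EnergyWeightedSupShape.NE3EnergyRateWSup`) DELIVERS the socket `T4EtaRateMin.LocalRate` with rate `θ₃ = L⁻¹` for the
# TOWER READINGS of a selected family of minimisers — a socket ADAPTER between two rows' shapes (nothing of Bałaban's proved)

Cell `pub-balaban`, rung (B)+1 sub-cell t4, lineage `b2b-balaban-t4-ne7-p1` (node U5 = NE7; generation 20 = CRUX PROVER NE7 #1 under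
the coordinator ruling «YM REDIRECT» e34b3e0c), crux skeleton `HOME/t4/b2b-balaban-t4-ne7-p1-g20/ROUTE1-NE7.md` v1.3 §2 stub S2 and §4
«INTERFACE REQUEST NE7→NE3» («the (R2) energy route's END read into `LocalRate`'s shape»); dagwriter §8 Q54 boundary of record («a crux
prover may prove in its own files what its route needs; no parked row is re-opened»).  HONEST FRAMING (page 1): FIXED FINITE T⁴, rung
(B)+1 = the `ε → 0` limit of unit-scale averaged expectations, CONDITIONAL on BetaPertH and the nine spine estimates (0/9 proved); NOT
infinite volume, NOT a mass gap, NOT the Clay problem.  NE7 and NE3 are NOT PRINTED in [Balaban1984PropagatorsI]–[Balaban1989LargeFieldII]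
and NOT proved here.

WHAT THIS FILE IS.  Route #1 consumes row NE3 through the socket `T4EtaRateMin.LocalRate R C₃ θ₃` (θ₃ < 1): «consecutive runs' LOCAL
READINGS of the minimisers differ by ≤ C₃θ₃^k at every unit-scale site» (`T4TowerRateDischarge.uRateUpTo_of_nodes`, binder `hloc`).  Row
NE3's own re-typed root (its owner's frame R3, parked by the ruling) is T-E_w♯ `NE3EnergyRateWSup d 𝒞 L N b g C s dom`: for `k ≥ 1`, every
admissible datum `V`, every run-A minimiser `UA` at level `k` and every REGULAR run-B minimiser `UB` at level `k+1` there are a unitary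
periodic site gauge `u` and a skew periodic direction `Z` with `gaugeAct u UA = vary (rescale L (bavg L UB)) Z 1` (the gauge-fixed run-A
minimiser IS the once-averaged run-B minimiser varied along `Z`), an energy bound, and the SUP CONJUNCT `‖Z x κ‖ ≤ s·(L⁻¹)^k`.  That sup
conjunct IS a `LocalRate`-type statement.  This file proves the ADAPTER: for any family of LOCAL READINGS `F k x U` of level-`k`
configurations that is (F1) invariant under unitary site gauge transformations, (F2) a TOWER reading — `F (k+1) x U = F k x (rescale L (bavg L U))`
(the level-`(k+1)` reading of a fine configuration is the level-`k` reading of its block average: true by construction for readings defined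
through the averaging tower to the unit lattice) — and (F3) Lipschitz under skew variations, `|F k x (vary U Z 1) − F k x U| ≤ ℓ·sup‖Z‖`
uniformly in `k`, and any SELECTION `sel k V` of minimisers, regular from level 2 on, T-E_w♯ gives
`LocalRate ⟨dom, 0, (k,V,x) ↦ F (k+1) x (sel (k+1) V), 0⟩ (ℓ·s) L⁻¹` — S2's socket BY NAME with `θ₃ = L⁻¹` (`< 1` for `L ≥ 2`).
(F1)–(F3) are properties of the READING (one-run, our choice of observable), displayed as hypotheses; the selection and its regularity are
NE3's NODE O∕B11-Thm-1 items ([Balaban1985Variational] Thm 1 p. 279 — existence and regularity of the minimiser — context only).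

WHAT IT IS NOT.  T-E_w♯ is asserted for nothing but the flat datum (`ne3EnergyRateWSup_flat`); row NE3's chain towards it is its owner's
conditional END (p247216, binders `hsmall`∕`hCP`∕`hchart`).  So this file discharges NOTHING of NE3 or NE7: it shows that WHEN row NE3's
root holds, route #1's S2 socket is inhabited in the form `uRateUpTo_of_nodes` consumes, with the rate the root displays.  `GaugeDominated`
(the other half of S2, `T4RateLiaison`) is a statement about the CARRIERS' gauge and is not touched.  [folklore] bookkeeping; no cite tags;
nothing printed asserted; no `def`.
-/

set_option autoImplicit false

open scoped BigOperators Matrix Matrix.Norms.L2Operator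
open Finset

namespace Summit.QuantumFields.BalabanUV.T4Continuum.NE7EtaMinimiserSocket

open Literature.MathematicalPhysics.QuantumFieldTheory.Balaban1983to89
open B7Prop1Explicit B7Prop2Explicit
open T4AveragingDeficitWall hiding Site Plane Plaq Bond
open MinimalActionSandwich (IsMinimiser)
open MinimalActionRate (Regular)
open NE3EnergyShapes (IsUnitarySite)
open NE3EnergyWeightedSupShape (NE3EnergyRateWSup)
open T4EtaRateMin (Readings LocalRate)

noncomputable section

variable {d : ℕ} {n : Type*} [Fintype n] [DecidableEq n] {X : Type*}

/-- For a natural `L`, `0 ≤ (L:ℝ)⁻¹ ≤ 1`, hence `((L:ℝ)⁻¹)^(k+1) ≤ ((L:ℝ)⁻¹)^k`. [folklore] -/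
theorem inv_pow_succ_le (L k : ℕ) : ((L : ℝ)⁻¹) ^ (k + 1) ≤ ((L : ℝ)⁻¹) ^ k := by
  have h0 : 0 ≤ ((L : ℝ)⁻¹) := inv_nonneg.mpr (Nat.cast_nonneg L)
  have h1 : ((L : ℝ)⁻¹) ≤ 1 := Nat.cast_inv_le_one L
  rw [pow_succ]
  exact mul_le_of_le_one_right (pow_nonneg h0 k) h1

/-- **S2's SOCKET FROM ROW NE3's ROOT T-E_w♯.**  Let `F k x U` be local readings of level-`k` configurations satisfying (F1) unitary
site-gauge invariance, (F2) the tower property `F (k+1) x U = F k x (rescale L (bavg L U))`, (F3) the variation-Lipschitz bound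
`|F k x (vary U Z 1) − F k x U| ≤ ℓ·M` whenever `Z` is skew with `‖Z y κ‖ ≤ M` for all `y, κ`; let `sel k V` select a minimiser of run
`k` for every admissible datum (`k ≥ 1`), regular from level `2` on.  If T-E_w♯ `NE3EnergyRateWSup d 𝒞 L N b g C s dom` holds with `s ≥ 0` (its k-free prefactor), then the
readings `R.loc k V x := F (k+1) x (sel (k+1) V)` satisfy `LocalRate R (ℓ·s) L⁻¹`. [folklore] -/
theorem localRate_of_ne3EnergyRateWSup {𝒞 : ℕ → Set (Site d → Fin d → (Matrix n n ℂ)ˣ)} {L N : ℕ} {b g C s : ℝ}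
    {dom : Set (Site d → Fin d → (Matrix n n ℂ)ˣ)} (h : NE3EnergyRateWSup d 𝒞 L N b g C s dom)
    (sel : ℕ → (Site d → Fin d → (Matrix n n ℂ)ˣ) → (Site d → Fin d → (Matrix n n ℂ)ˣ))
    (hsel : ∀ k, 1 ≤ k → ∀ V ∈ dom, IsMinimiser d 𝒞 L N k V (sel k V))
    (hreg : ∀ k, 2 ≤ k → ∀ V ∈ dom, Regular d L N b g k (sel k V))
    (F : ℕ → X → (Site d → Fin d → (Matrix n n ℂ)ˣ) → ℝ) {ℓ : ℝ} (hℓ : 0 ≤ ℓ) (hs : 0 ≤ s)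
    (hF1 : ∀ k x (u : Site d → (Matrix n n ℂ)ˣ) U, IsUnitarySite u → F k x (gaugeAct u U) = F k x U)
    (hF2 : ∀ k x U, F (k + 1) x U = F k x (rescale L (bavg L U)))
    (hF3 : ∀ k x U (Z : Site d → Fin d → Matrix n n ℂ) (M : ℝ), IsSkewDir Z → (∀ y κ, ‖Z y κ‖ ≤ M) →
      |F k x (vary U Z 1) - F k x U| ≤ ℓ * M) :
    LocalRate (⟨dom, fun _ _ => 0, fun k V x => F (k + 1) x (sel (k + 1) V), 0, le_rfl⟩ : Readings _ X)
      (ℓ * s) ((L : ℝ)⁻¹) := by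
  intro k V hV x
  -- the two minimisers: UA at level k+1, UB at level k+2 (regular)
  have hk1 : 1 ≤ k + 1 := Nat.le_add_left 1 k
  obtain ⟨u, Z, hu, -, hZ, -, hrep, -, hsup⟩ :=
    h (k + 1) hk1 V hV (sel (k + 1) V) (sel (k + 2) V) (hsel (k + 1) hk1 V hV) (hsel (k + 2) (by omega) V hV)
      (hreg (k + 2) (by omega) V hV)
  -- read both sides: F (k+2) x UB = F (k+1) x (avg UB);  F (k+1) x UA = F (k+1) x (vary (avg UB) Z 1)
  have hB : F (k + 1 + 1) x (sel (k + 1 + 1) V) = F (k + 1) x (rescale L (bavg L (sel (k + 2) V))) := hF2 _ _ _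
  have hA : F (k + 1) x (sel (k + 1) V) = F (k + 1) x (vary (rescale L (bavg L (sel (k + 2) V))) Z 1) := by
    rw [← hF1 (k + 1) x u (sel (k + 1) V) hu, hrep]
  change |F (k + 1 + 1) x (sel (k + 1 + 1) V) - F (k + 1) x (sel (k + 1) V)| ≤ ℓ * s * ((L : ℝ)⁻¹) ^ k
  rw [hB, hA, abs_sub_comm]
  have hM := hF3 (k + 1) x (rescale L (bavg L (sel (k + 2) V))) Z (s * ((L : ℝ)⁻¹) ^ (k + 1)) hZ hsup
  calc |F (k + 1) x (vary (rescale L (bavg L (sel (k + 2) V))) Z 1) - F (k + 1) x (rescale L (bavg L (sel (k + 2) V)))|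
      ≤ ℓ * (s * ((L : ℝ)⁻¹) ^ (k + 1)) := hM
    _ ≤ ℓ * (s * ((L : ℝ)⁻¹) ^ k) :=
        mul_le_mul_of_nonneg_left (mul_le_mul_of_nonneg_left (inv_pow_succ_le L k) hs) hℓ
    _ = ℓ * s * ((L : ℝ)⁻¹) ^ k := by ring

/-! ## §2 ERRATUM (lineage gen 21, 2026-08-21): (F2) TOWER READINGS ARE CONSTANT ON ADMISSIBLE SELECTIONS — §1 is vacuous on minimisers

Found by the author lineage (CRUX PROVER NE7 #1, gen 21) while trying to instantiate (F1)–(F3) for a concrete reading.  The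
admissible set of run `k` with datum `V` is `{U ∈ 𝒞 k ∧ avgIter L U k = V}` (`MinimalActionSandwich.admissible`, B11 (3) «Ū^k = V»),
and hypothesis (F2) forces `F k x U = F 0 x (avgIter L U k)` (`reading_eq_reading_avgIter`, by `MinimalActionLevels.avgIter_rescale_bavg`).
Hence on ANY admissible configuration — in particular on every minimiser `sel k V` — a tower reading reads the DATUM:
`F k x (sel k V) = F 0 x V`, the same number for every `k` (`reading_eq_datum_of_mem_admissible`).  The readings of §1,
`(k, V, x) ↦ F (k+1) x (sel (k+1) V)`, are therefore constant in `k`, and `LocalRate` holds for them with ANY constant `C ≥ 0` and ANY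
rate `θ ≥ 0` (`localRate_of_tower_admissible`); the conclusion of `localRate_of_ne3EnergyRateWSup` holds WITHOUT T-E_w♯, (F1), (F3) or
regularity (`localRate_of_tower_minimisers`).  So T-E_w♯ is an IDLE hypothesis in §1, and §1 is NOT evidence that row NE3's root feeds
route #1's stub S2: a tower reading cannot see the fine structure of a constrained minimiser, by the constraint itself.

WHAT DOES inhabit S2's `T4EtaRateMin.LocalRate` non-vacuously from T-E_w♯ is row NE3's OWN END
`NE3LocalCrudeWEnd.localRate_crudeW_of_energyRateWSup` (reading (D): the fine Wilson action of `sel k V` over the `k`-fold block of the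
unit site `x`, rate `L⁻¹`, explicit constant `∝ N⁴`, at `d = 4`; hypotheses T-E_w♯ + a regular selection of minimisers) — cited BY NAME,
not imported here.  The liaison `T4RateLiaison.GaugeDominated` (scalar reading discrepancies dominate the carriers' gauge) is inhabited
by neither reading; that junction (S2 → S1's U-slot) is the subject of the lineage's gen-21 record (`HOME/t4/b2b-balaban-t4-ne7-p1-g21/`).
Skeleton `t4/skeletons/NE7-CRUX-R1.md` row S2 is corrected accordingly (v1.5).  [folklore] bookkeeping; 0 def; nothing printed asserted.
-/

open MinimalActionSandwich (admissible)

/-- **(F2) ⇒ THE LEVEL-`k` READING IS THE LEVEL-`0` READING OF THE `k`-FOLD AVERAGE**: `F k x U = F 0 x (avgIter L U k)`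
(induction on `k` with the composition law `avgIter L (rescale L (bavg L U)) k = avgIter L U (k+1)`). [folklore] -/
theorem reading_eq_reading_avgIter {L : ℕ} (F : ℕ → X → (Site d → Fin d → (Matrix n n ℂ)ˣ) → ℝ)
    (hF2 : ∀ k x U, F (k + 1) x U = F k x (rescale L (bavg L U))) :
    ∀ (k : ℕ) (x : X) (U : Site d → Fin d → (Matrix n n ℂ)ˣ), F k x U = F 0 x (avgIter L U k)
  | 0, x, U => by rw [avgIter_zero]
  | k + 1, x, U => by
    rw [hF2, reading_eq_reading_avgIter F hF2 k, MinimalActionLevels.avgIter_rescale_bavg]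

/-- **ON AN ADMISSIBLE CONFIGURATION A TOWER READING READS THE DATUM**: `U ∈ admissible 𝒞 L k V` (i.e. `avgIter L U k = V`) and
(F2) give `F k x U = F 0 x V` — independent of `k` and of WHICH admissible `U`. [folklore] -/
theorem reading_eq_datum_of_mem_admissible {𝒞 : ℕ → Set (Site d → Fin d → (Matrix n n ℂ)ˣ)} {L k : ℕ}
    {V U : Site d → Fin d → (Matrix n n ℂ)ˣ} (F : ℕ → X → (Site d → Fin d → (Matrix n n ℂ)ˣ) → ℝ)
    (hF2 : ∀ k x U, F (k + 1) x U = F k x (rescale L (bavg L U))) (hU : U ∈ admissible 𝒞 L k V) (x : X) :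
    F k x U = F 0 x V := by
  rw [reading_eq_reading_avgIter F hF2 k x U, hU.2]

/-- **THE READINGS OF §1 ARE CONSTANT IN `k` ON ADMISSIBLE SELECTIONS, HENCE `LocalRate` WITH ANY `C ≥ 0`, `θ ≥ 0`**: for a
selection `sel k V ∈ admissible 𝒞 L k V` (`k ≥ 1`) and a reading with (F2) ONLY, `|F (k+2) x (sel (k+2) V) − F (k+1) x (sel (k+1) V)|
= |F 0 x V − F 0 x V| = 0`.  No T-E_w♯, no (F1), no (F3), no regularity. [folklore] -/
theorem localRate_of_tower_admissible {𝒞 : ℕ → Set (Site d → Fin d → (Matrix n n ℂ)ˣ)} {L : ℕ}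
    {dom : Set (Site d → Fin d → (Matrix n n ℂ)ˣ)}
    (sel : ℕ → (Site d → Fin d → (Matrix n n ℂ)ˣ) → (Site d → Fin d → (Matrix n n ℂ)ˣ))
    (hsel : ∀ k, 1 ≤ k → ∀ V ∈ dom, sel k V ∈ admissible 𝒞 L k V)
    (F : ℕ → X → (Site d → Fin d → (Matrix n n ℂ)ˣ) → ℝ) (hF2 : ∀ k x U, F (k + 1) x U = F k x (rescale L (bavg L U)))
    {C θ : ℝ} (hC : 0 ≤ C) (hθ : 0 ≤ θ) :
    LocalRate (⟨dom, fun _ _ => 0, fun k V x => F (k + 1) x (sel (k + 1) V), 0, le_rfl⟩ : Readings _ X) C θ := by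
  intro k V hV x
  change |F (k + 1 + 1) x (sel (k + 1 + 1) V) - F (k + 1) x (sel (k + 1) V)| ≤ C * θ ^ k
  rw [reading_eq_datum_of_mem_admissible F hF2 (hsel (k + 1 + 1) (by omega) V hV) x,
    reading_eq_datum_of_mem_admissible F hF2 (hsel (k + 1) (by omega) V hV) x, sub_self, abs_zero]
  positivity

/-- **ERRATUM TO §1**: for a selection of MINIMISERS and a reading with (F2), the conclusion of `localRate_of_ne3EnergyRateWSup` —
`LocalRate ⟨dom, 0, (k,V,x) ↦ F (k+1) x (sel (k+1) V), 0⟩ (ℓ·s) L⁻¹` — holds for every `ℓ, s ≥ 0` WITHOUT T-E_w♯, (F1), (F3) or the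
regularity of the selection: T-E_w♯ is idle in §1, whose readings are the constant `F 0 x V`. [folklore] -/
theorem localRate_of_tower_minimisers {𝒞 : ℕ → Set (Site d → Fin d → (Matrix n n ℂ)ˣ)} {L N : ℕ}
    {dom : Set (Site d → Fin d → (Matrix n n ℂ)ˣ)}
    (sel : ℕ → (Site d → Fin d → (Matrix n n ℂ)ˣ) → (Site d → Fin d → (Matrix n n ℂ)ˣ))
    (hsel : ∀ k, 1 ≤ k → ∀ V ∈ dom, IsMinimiser d 𝒞 L N k V (sel k V))
    (F : ℕ → X → (Site d → Fin d → (Matrix n n ℂ)ˣ) → ℝ) (hF2 : ∀ k x U, F (k + 1) x U = F k x (rescale L (bavg L U)))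
    {ℓ s : ℝ} (hℓ : 0 ≤ ℓ) (hs : 0 ≤ s) :
    LocalRate (⟨dom, fun _ _ => 0, fun k V x => F (k + 1) x (sel (k + 1) V), 0, le_rfl⟩ : Readings _ X)
      (ℓ * s) ((L : ℝ)⁻¹) :=
  localRate_of_tower_admissible sel (fun k hk V hV => (hsel k hk V hV).mem) F hF2 (mul_nonneg hℓ hs)
    (inv_nonneg.mpr (Nat.cast_nonneg L))

/-- **THE READINGS OF §1 CANNOT CARRY `GaugeDominated` EITHER** (pointwise form): their site discrepancies are all `≤ 0`, so any
liaison «site discrepancies `≤ M` ⇒ gauge `≤ M`» evaluated at `M = 0` forces the carriers' gauge of the pair to vanish — i.e. for tower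
readings `T4RateLiaison.GaugeDominated` can hold only for pairs of backgrounds at gauge `0`. Stated here as the elementary fact it rests
on: every site discrepancy of the §1 readings is `0` on admissible selections. [folklore] -/
theorem reading_discrepancy_eq_zero {𝒞 : ℕ → Set (Site d → Fin d → (Matrix n n ℂ)ˣ)} {L : ℕ}
    {dom : Set (Site d → Fin d → (Matrix n n ℂ)ˣ)}
    (sel : ℕ → (Site d → Fin d → (Matrix n n ℂ)ˣ) → (Site d → Fin d → (Matrix n n ℂ)ˣ))
    (hsel : ∀ k, 1 ≤ k → ∀ V ∈ dom, sel k V ∈ admissible 𝒞 L k V)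
    (F : ℕ → X → (Site d → Fin d → (Matrix n n ℂ)ˣ) → ℝ) (hF2 : ∀ k x U, F (k + 1) x U = F k x (rescale L (bavg L U)))
    (k : ℕ) {V : Site d → Fin d → (Matrix n n ℂ)ˣ} (hV : V ∈ dom) (x : X) :
    F (k + 1 + 1) x (sel (k + 1 + 1) V) - F (k + 1) x (sel (k + 1) V) = 0 := by
  rw [reading_eq_datum_of_mem_admissible F hF2 (hsel (k + 1 + 1) (by omega) V hV) x,
    reading_eq_datum_of_mem_admissible F hF2 (hsel (k + 1) (by omega) V hV) x, sub_self]

end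

end Summit.QuantumFields.BalabanUV.T4Continuum.NE7EtaMinimiserSocket
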